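import Summits.QuantumFields.BalabanUV.Gaps.CapTailPinnedLimitSign

/-!
# `BalabanUV.Gaps.D1PinnedBorderWeightSocket` — cell pub-balaban-gaps, row (D1), seat g1-p1: THE BORDER-WEIGHT SOCKET OF THE PINNED LITERAL — if the
# one-loop step coefficients of `JsBalAn1 … cE cVH cΛ cE₂ cB Tc` are AFFINE in the (free, (P6)-unpinned) second-order border weight `cB` at every step
# (ONE displayed hypothesis `haff`, the successor's charge — census row 62 (a)), then so is their limit, and (D1) at the pinned literal is EITHER `cB`-BLIND OR
# ONE AFFINE EQUATION IN `cB`: met by EXACTLY ONE `cB` for every numeral, with `lim β⁰` taking EVERY real value along the `cB`-line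

HONEST FRAMING (cell rule, page 1 of everything): [folklore] real-sequence algebra (`Filter.Tendsto.add ∕ const_mul`, `tendsto_nhds_unique`) over g1-p3's
hypothesis-free `CapTailPinnedLimitSign.tendsto_pinned` ∕ `d1Drift_pinned_iff_lim_eq` (gan24-p1's rate BY NAME).  The load-bearing input `haff` — step-wise
affinity of `j ↦ secondMoment (TbalOf Lc (JsBalAn1 … cB …) j) μ ν` in `cB` — is a HYPOTHESIS displayed in every signature, NOT proved here (its located route:
`cB` enters the step kernels only through an2's recursive bi-stencil family `BalabanStepW2.T2Of`, member 0 `cE₂•wilsonW₂ Tc + cB•mfNeg vh₂S`, member `j+1`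
`cE₂·wV4•e4OfW j … (WbalOf … (T2Of …) … j) + cB·wB2•mfNeg vh₂S`, every map on the way affine in its table slot — `GAN24.T2RecursionAffine.W2SymOfK_eq_add_vsym`,
`GAN24.Lin4Additive.vertex2OfK_add ∕ _smul`, `GAN24.T2RecursionAffine.K3OfK_eq_sub_of_W`, `VertexReflectionContact.mmRead_add`, `FP.WSlotSplit.hessKer_add_W`,
`ScalewiseWitness.secondMoment_add ∕ _smul`; census row 62 (a) of `HOME/g1/RESIDUE.md` part (D1)).  NOTHING of Bałaban's is asserted beyond print;
[Balaban1987RG1] Thm 2 is UNPROVED IN PRINT; whether print's border weight makes the literal's (D1) true is the wall itself; 0 coefficients certified;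
(D1) NOT discharged at any literal; 0∕4 row-D1 binders; NOT `BetaPertH`, NOT the continuum limit, NOT Clay.  HONEST DEPENDENCY (b2b cell, verbatim):
«continuum YM on T⁴ ⇐ BetaPertH ∧ nine spine estimates (0/9 proved); BetaPertH ⇐ (D1) ∧ (D4) ∧ CAP+tail; G-an2-4 gates asym, D1 and NE2/3/4.»

WHY (row (D1); (P6) «colour constants pinned LAST»).  At the β-lead's pinned literal the binder (D1) is ONE real identity `lim β⁰ = stepBal N Lc`
(`CapTailPinnedLimitSign.d1Drift_pinned_iff_lim_eq`; = `M∞`, GEN 9's `D1PinnedLimitClosedForm`) over a family whose colour data `cE cVH cΛ cB Tc` are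
FREE.  This file records, kernel-checked, what the freedom of ONE of them — the second-order border weight `cB`, which enters linearly — does to the
evidential weight of «(D1) at the pinned literal» ONCE the step-wise affinity `haff` is supplied: with `ℓ₀ := lim β⁰(cB := 0)`, `ℓ₁ := lim β⁰(cB := 1)`,
* `lim β⁰(cB) = (1 − cB)·ℓ₀ + cB·ℓ₁` (**`lim_affine_of_stepwise_affine`**);
* `ℓ₁ = ℓ₀` ⟹ (D1) and the END bit are `cB`-BLIND (**`d1Drift_iff_d1Drift_zero_of_blind`**, **`lim_eq_lim_zero_of_blind`**);
* `ℓ₁ ≠ ℓ₀` ⟹ `lim β⁰` takes EVERY real value along the `cB`-line (**`exists_borderWeight_lim_eq`**), so for EVERY numeral `N` SOME `cB` meets (D1)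
  (**`exists_borderWeight_d1Drift`**) and EXACTLY ONE does (**`existsUnique_borderWeight_d1Drift`**, `cB⋆ = (stepBal N Lc − ℓ₀)∕(ℓ₁ − ℓ₀)`), while SOME `cB`
  makes the END bit hold and SOME makes it fail (**`exists_borderWeight_limPos`**, **`exists_borderWeight_limNeg`**).
READING (zero classification weight): under `haff`, «(D1) holds at the pinned literal» is either independent of `cB` or a DEFINITION of `cB`; in the second case
it carries weight for the wall only together with print's value of the border weight ((P6)).  Which case holds, and `haff` itself, are OPEN — the successor's
typed target (row 62 (a)).

CONTENT (all [folklore]; no `def`, no `def … : Prop`, nothing cited as a hypothesis, 0 sorry; `2 ≤ Lc`, `r ∈ box 4 Lc`, any `cE cVH cΛ Tc`, any channel).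

ABSOLUTE RULE (cell charter, verbatim): «No internally-minted statement may enter as a cited fact. Every hypothesis is either kernel-proved in this
package or a verbatim quotation of a PUBLISHED theorem with page reference. The manuscript(s) under audit are NOT citable for their own disputed
steps — they are the thing under adjudication; programme-internal (2001/route/tribunal) claims are never citable.»

Provenance: cell pub-balaban-gaps, seat g1-p1 GEN 9 (prover-pub-balaban-gaps-g1-p1-g9-0), 2026-08-23; imports g1-p3's `Gaps/CapTailPinnedLimitSign` ONLY; every tree theorem
used BY NAME; no existing file touched; independent of the other GEN 9 files.
-/

noncomputable section

open Filter Topology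
open Literature.MathematicalPhysics.QuantumFieldTheory
open Literature.MathematicalPhysics.QuantumFieldTheory.Balaban1983to89
open Literature.MathematicalPhysics.QuantumFieldTheory.Balaban1983to89.Beta
open AffineAveraging (box)
open OneStepKernelFamily (D1Drift TbalOf)
open RateCertificate (CauchyRate)
open Summit.QuantumFields.BalabanUV.Beta.MixedJetTablesPlug (JsBalAn1)
open Summit.QuantumFields.BalabanUV.Beta.GAN24.StencilSlotOfE3 (one_le_of_two_le)
open Summit.QuantumFields.BalabanUV.Gaps.CapTailPinnedLimitSign (tendsto_pinned d1Drift_pinned_iff_lim_eq)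

namespace Summit.QuantumFields.BalabanUV.Gaps.D1PinnedBorderWeightSocket

variable {Lc : ℕ} [NeZero Lc] {r : Fin (3 + 1) → ℕ}

/-! ## §1 The limit is affine in the border weight once every step coefficient is -/

/-- [folklore] **STEP-WISE AFFINITY IN `cB` PASSES TO THE LIMIT**: if for every `j` the step coefficient at border weight `cB` is the affine combination
`(1 − cB)·β⁰_j(0) + cB·β⁰_j(1)`, then `lim β⁰(cB) = (1 − cB)·lim β⁰(0) + cB·lim β⁰(1)` — g1-p3's hypothesis-free `tendsto_pinned` at `cB`, `0`, `1` and
uniqueness of limits.  `haff` is the ONE hypothesis (NOT proved here). -/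
theorem lim_affine_of_stepwise_affine (hLc : 2 ≤ Lc) (hr : r ∈ box (3 + 1) Lc) (cE cVH cΛ : ℝ)
    (Tc : Fin 4 → Fin 4 → Fin 4 → Fin 4 → ℝ) (μ ν : Fin 4) (cB : ℝ)
    (haff : ∀ j : ℕ, B12Beta.secondMoment (TbalOf Lc (JsBalAn1 (one_le_of_two_le hLc) hr cE cVH cΛ ((Lc : ℝ) ^ (2 * (3 + 1))) cB Tc) j) μ ν =
      (1 - cB) * B12Beta.secondMoment (TbalOf Lc (JsBalAn1 (one_le_of_two_le hLc) hr cE cVH cΛ ((Lc : ℝ) ^ (2 * (3 + 1))) 0 Tc) j) μ ν + cB * B12Beta.secondMoment (TbalOf Lc (JsBalAn1 (one_le_of_two_le hLc) hr cE cVH cΛ ((Lc : ℝ) ^ (2 * (3 + 1))) 1 Tc) j) μ ν) :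
    CauchyRate.lim (fun j => B12Beta.secondMoment (TbalOf Lc (JsBalAn1 (one_le_of_two_le hLc) hr cE cVH cΛ ((Lc : ℝ) ^ (2 * (3 + 1))) cB Tc) j) μ ν) =
      (1 - cB) * CauchyRate.lim (fun j => B12Beta.secondMoment (TbalOf Lc (JsBalAn1 (one_le_of_two_le hLc) hr cE cVH cΛ ((Lc : ℝ) ^ (2 * (3 + 1))) 0 Tc) j) μ ν) +
        cB * CauchyRate.lim (fun j => B12Beta.secondMoment (TbalOf Lc (JsBalAn1 (one_le_of_two_le hLc) hr cE cVH cΛ ((Lc : ℝ) ^ (2 * (3 + 1))) 1 Tc) j) μ ν) := by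
  have hc := tendsto_pinned hLc hr cE cVH cΛ cB Tc μ ν
  have h0 := tendsto_pinned hLc hr cE cVH cΛ 0 Tc μ ν
  have h1 := tendsto_pinned hLc hr cE cVH cΛ 1 Tc μ ν
  have h' := (h0.const_mul (1 - cB)).add (h1.const_mul cB)
  exact tendsto_nhds_unique hc (h'.congr fun j => (haff j).symm)

/-! ## §2 The blind case `ℓ₁ = ℓ₀`: (D1) and the END bit do not see `cB` -/

/-- [folklore] **BLIND CASE, LIMIT**: under step-wise affinity for every `cB`, `lim β⁰(1) = lim β⁰(0)` ⟹ `lim β⁰(cB) = lim β⁰(0)` for every `cB`. -/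
theorem lim_eq_lim_zero_of_blind (hLc : 2 ≤ Lc) (hr : r ∈ box (3 + 1) Lc) (cE cVH cΛ : ℝ)
    (Tc : Fin 4 → Fin 4 → Fin 4 → Fin 4 → ℝ) (μ ν : Fin 4)
    (haff : ∀ (cB : ℝ) (j : ℕ), B12Beta.secondMoment (TbalOf Lc (JsBalAn1 (one_le_of_two_le hLc) hr cE cVH cΛ ((Lc : ℝ) ^ (2 * (3 + 1))) cB Tc) j) μ ν =
      (1 - cB) * B12Beta.secondMoment (TbalOf Lc (JsBalAn1 (one_le_of_two_le hLc) hr cE cVH cΛ ((Lc : ℝ) ^ (2 * (3 + 1))) 0 Tc) j) μ ν + cB * B12Beta.secondMoment (TbalOf Lc (JsBalAn1 (one_le_of_two_le hLc) hr cE cVH cΛ ((Lc : ℝ) ^ (2 * (3 + 1))) 1 Tc) j) μ ν)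
    (hblind : CauchyRate.lim (fun j => B12Beta.secondMoment (TbalOf Lc (JsBalAn1 (one_le_of_two_le hLc) hr cE cVH cΛ ((Lc : ℝ) ^ (2 * (3 + 1))) 1 Tc) j) μ ν) =
      CauchyRate.lim (fun j => B12Beta.secondMoment (TbalOf Lc (JsBalAn1 (one_le_of_two_le hLc) hr cE cVH cΛ ((Lc : ℝ) ^ (2 * (3 + 1))) 0 Tc) j) μ ν)) (cB : ℝ) :
    CauchyRate.lim (fun j => B12Beta.secondMoment (TbalOf Lc (JsBalAn1 (one_le_of_two_le hLc) hr cE cVH cΛ ((Lc : ℝ) ^ (2 * (3 + 1))) cB Tc) j) μ ν) =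
      CauchyRate.lim (fun j => B12Beta.secondMoment (TbalOf Lc (JsBalAn1 (one_le_of_two_le hLc) hr cE cVH cΛ ((Lc : ℝ) ^ (2 * (3 + 1))) 0 Tc) j) μ ν) := by
  rw [lim_affine_of_stepwise_affine hLc hr cE cVH cΛ Tc μ ν cB (haff cB), hblind]
  ring

/-- [folklore] **BLIND CASE, (D1)**: under step-wise affinity, `lim β⁰(1) = lim β⁰(0)` ⟹ for every numeral `N` and every `cB`,
`D1Drift Lc (JsBalAn1 … cB …) N μ ν ↔ D1Drift Lc (JsBalAn1 … 0 …) N μ ν` (g1-p3's `d1Drift_pinned_iff_lim_eq` twice). -/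
theorem d1Drift_iff_d1Drift_zero_of_blind (hLc : 2 ≤ Lc) (hr : r ∈ box (3 + 1) Lc) (cE cVH cΛ : ℝ)
    (Tc : Fin 4 → Fin 4 → Fin 4 → Fin 4 → ℝ) (μ ν : Fin 4)
    (haff : ∀ (cB : ℝ) (j : ℕ), B12Beta.secondMoment (TbalOf Lc (JsBalAn1 (one_le_of_two_le hLc) hr cE cVH cΛ ((Lc : ℝ) ^ (2 * (3 + 1))) cB Tc) j) μ ν =
      (1 - cB) * B12Beta.secondMoment (TbalOf Lc (JsBalAn1 (one_le_of_two_le hLc) hr cE cVH cΛ ((Lc : ℝ) ^ (2 * (3 + 1))) 0 Tc) j) μ ν + cB * B12Beta.secondMoment (TbalOf Lc (JsBalAn1 (one_le_of_two_le hLc) hr cE cVH cΛ ((Lc : ℝ) ^ (2 * (3 + 1))) 1 Tc) j) μ ν)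
    (hblind : CauchyRate.lim (fun j => B12Beta.secondMoment (TbalOf Lc (JsBalAn1 (one_le_of_two_le hLc) hr cE cVH cΛ ((Lc : ℝ) ^ (2 * (3 + 1))) 1 Tc) j) μ ν) =
      CauchyRate.lim (fun j => B12Beta.secondMoment (TbalOf Lc (JsBalAn1 (one_le_of_two_le hLc) hr cE cVH cΛ ((Lc : ℝ) ^ (2 * (3 + 1))) 0 Tc) j) μ ν)) (cB N : ℝ) :
    D1Drift Lc (JsBalAn1 (one_le_of_two_le hLc) hr cE cVH cΛ ((Lc : ℝ) ^ (2 * (3 + 1))) cB Tc) N μ ν ↔ D1Drift Lc (JsBalAn1 (one_le_of_two_le hLc) hr cE cVH cΛ ((Lc : ℝ) ^ (2 * (3 + 1))) 0 Tc) N μ ν := by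
  rw [d1Drift_pinned_iff_lim_eq hLc hr cE cVH cΛ cB Tc μ ν N, d1Drift_pinned_iff_lim_eq hLc hr cE cVH cΛ 0 Tc μ ν N,
    lim_eq_lim_zero_of_blind hLc hr cE cVH cΛ Tc μ ν haff hblind cB]

/-! ## §3 The generic case `ℓ₁ ≠ ℓ₀`: the limit sweeps ℝ along the `cB`-line; (D1) DEFINES `cB` -/

/-- [folklore] **GENERIC CASE, SURJECTIVITY**: under step-wise affinity, `lim β⁰(1) ≠ lim β⁰(0)` ⟹ for every real `t` SOME border weight has `lim β⁰(cB) = t`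
(`cB := (t − ℓ₀)∕(ℓ₁ − ℓ₀)`). -/
theorem exists_borderWeight_lim_eq (hLc : 2 ≤ Lc) (hr : r ∈ box (3 + 1) Lc) (cE cVH cΛ : ℝ)
    (Tc : Fin 4 → Fin 4 → Fin 4 → Fin 4 → ℝ) (μ ν : Fin 4)
    (haff : ∀ (cB : ℝ) (j : ℕ), B12Beta.secondMoment (TbalOf Lc (JsBalAn1 (one_le_of_two_le hLc) hr cE cVH cΛ ((Lc : ℝ) ^ (2 * (3 + 1))) cB Tc) j) μ ν =
      (1 - cB) * B12Beta.secondMoment (TbalOf Lc (JsBalAn1 (one_le_of_two_le hLc) hr cE cVH cΛ ((Lc : ℝ) ^ (2 * (3 + 1))) 0 Tc) j) μ ν + cB * B12Beta.secondMoment (TbalOf Lc (JsBalAn1 (one_le_of_two_le hLc) hr cE cVH cΛ ((Lc : ℝ) ^ (2 * (3 + 1))) 1 Tc) j) μ ν)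
    (hgen : CauchyRate.lim (fun j => B12Beta.secondMoment (TbalOf Lc (JsBalAn1 (one_le_of_two_le hLc) hr cE cVH cΛ ((Lc : ℝ) ^ (2 * (3 + 1))) 1 Tc) j) μ ν) ≠
      CauchyRate.lim (fun j => B12Beta.secondMoment (TbalOf Lc (JsBalAn1 (one_le_of_two_le hLc) hr cE cVH cΛ ((Lc : ℝ) ^ (2 * (3 + 1))) 0 Tc) j) μ ν)) (t : ℝ) :
    ∃ cB : ℝ, CauchyRate.lim (fun j => B12Beta.secondMoment (TbalOf Lc (JsBalAn1 (one_le_of_two_le hLc) hr cE cVH cΛ ((Lc : ℝ) ^ (2 * (3 + 1))) cB Tc) j) μ ν) = t := by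
  refine ⟨(t - CauchyRate.lim (fun j => B12Beta.secondMoment (TbalOf Lc (JsBalAn1 (one_le_of_two_le hLc) hr cE cVH cΛ ((Lc : ℝ) ^ (2 * (3 + 1))) 0 Tc) j) μ ν)) /
      (CauchyRate.lim (fun j => B12Beta.secondMoment (TbalOf Lc (JsBalAn1 (one_le_of_two_le hLc) hr cE cVH cΛ ((Lc : ℝ) ^ (2 * (3 + 1))) 1 Tc) j) μ ν) -
        CauchyRate.lim (fun j => B12Beta.secondMoment (TbalOf Lc (JsBalAn1 (one_le_of_two_le hLc) hr cE cVH cΛ ((Lc : ℝ) ^ (2 * (3 + 1))) 0 Tc) j) μ ν)), ?_⟩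
  rw [lim_affine_of_stepwise_affine hLc hr cE cVH cΛ Tc μ ν _ (haff _)]
  have hne := sub_ne_zero.mpr hgen
  field_simp
  ring

/-- [folklore] **GENERIC CASE, (D1) IS MET BY SOME BORDER WEIGHT FOR EVERY NUMERAL**: `lim β⁰(1) ≠ lim β⁰(0)` ⟹ `∀ N, ∃ cB, D1Drift Lc (JsBalAn1 … cB …) N μ ν`. -/
theorem exists_borderWeight_d1Drift (hLc : 2 ≤ Lc) (hr : r ∈ box (3 + 1) Lc) (cE cVH cΛ : ℝ)
    (Tc : Fin 4 → Fin 4 → Fin 4 → Fin 4 → ℝ) (μ ν : Fin 4)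
    (haff : ∀ (cB : ℝ) (j : ℕ), B12Beta.secondMoment (TbalOf Lc (JsBalAn1 (one_le_of_two_le hLc) hr cE cVH cΛ ((Lc : ℝ) ^ (2 * (3 + 1))) cB Tc) j) μ ν =
      (1 - cB) * B12Beta.secondMoment (TbalOf Lc (JsBalAn1 (one_le_of_two_le hLc) hr cE cVH cΛ ((Lc : ℝ) ^ (2 * (3 + 1))) 0 Tc) j) μ ν + cB * B12Beta.secondMoment (TbalOf Lc (JsBalAn1 (one_le_of_two_le hLc) hr cE cVH cΛ ((Lc : ℝ) ^ (2 * (3 + 1))) 1 Tc) j) μ ν)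
    (hgen : CauchyRate.lim (fun j => B12Beta.secondMoment (TbalOf Lc (JsBalAn1 (one_le_of_two_le hLc) hr cE cVH cΛ ((Lc : ℝ) ^ (2 * (3 + 1))) 1 Tc) j) μ ν) ≠
      CauchyRate.lim (fun j => B12Beta.secondMoment (TbalOf Lc (JsBalAn1 (one_le_of_two_le hLc) hr cE cVH cΛ ((Lc : ℝ) ^ (2 * (3 + 1))) 0 Tc) j) μ ν)) (N : ℝ) :
    ∃ cB : ℝ, D1Drift Lc (JsBalAn1 (one_le_of_two_le hLc) hr cE cVH cΛ ((Lc : ℝ) ^ (2 * (3 + 1))) cB Tc) N μ ν := by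
  obtain ⟨cB, hcB⟩ := exists_borderWeight_lim_eq hLc hr cE cVH cΛ Tc μ ν haff hgen (B12Normalization.stepBal N Lc)
  exact ⟨cB, (d1Drift_pinned_iff_lim_eq hLc hr cE cVH cΛ cB Tc μ ν N).mpr hcB⟩

/-- [folklore] **GENERIC CASE, (D1) DEFINES THE BORDER WEIGHT**: `lim β⁰(1) ≠ lim β⁰(0)` ⟹ for every numeral `N` there is EXACTLY ONE `cB` with
`D1Drift Lc (JsBalAn1 … cB …) N μ ν` (namely `cB⋆ = (stepBal N Lc − ℓ₀)∕(ℓ₁ − ℓ₀)`). -/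
theorem existsUnique_borderWeight_d1Drift (hLc : 2 ≤ Lc) (hr : r ∈ box (3 + 1) Lc) (cE cVH cΛ : ℝ)
    (Tc : Fin 4 → Fin 4 → Fin 4 → Fin 4 → ℝ) (μ ν : Fin 4)
    (haff : ∀ (cB : ℝ) (j : ℕ), B12Beta.secondMoment (TbalOf Lc (JsBalAn1 (one_le_of_two_le hLc) hr cE cVH cΛ ((Lc : ℝ) ^ (2 * (3 + 1))) cB Tc) j) μ ν =
      (1 - cB) * B12Beta.secondMoment (TbalOf Lc (JsBalAn1 (one_le_of_two_le hLc) hr cE cVH cΛ ((Lc : ℝ) ^ (2 * (3 + 1))) 0 Tc) j) μ ν + cB * B12Beta.secondMoment (TbalOf Lc (JsBalAn1 (one_le_of_two_le hLc) hr cE cVH cΛ ((Lc : ℝ) ^ (2 * (3 + 1))) 1 Tc) j) μ ν)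
    (hgen : CauchyRate.lim (fun j => B12Beta.secondMoment (TbalOf Lc (JsBalAn1 (one_le_of_two_le hLc) hr cE cVH cΛ ((Lc : ℝ) ^ (2 * (3 + 1))) 1 Tc) j) μ ν) ≠
      CauchyRate.lim (fun j => B12Beta.secondMoment (TbalOf Lc (JsBalAn1 (one_le_of_two_le hLc) hr cE cVH cΛ ((Lc : ℝ) ^ (2 * (3 + 1))) 0 Tc) j) μ ν)) (N : ℝ) :
    ∃! cB : ℝ, D1Drift Lc (JsBalAn1 (one_le_of_two_le hLc) hr cE cVH cΛ ((Lc : ℝ) ^ (2 * (3 + 1))) cB Tc) N μ ν := by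
  obtain ⟨cB, hcB⟩ := exists_borderWeight_d1Drift hLc hr cE cVH cΛ Tc μ ν haff hgen N
  refine ⟨cB, hcB, fun cB' hcB' => ?_⟩
  have h1 := (d1Drift_pinned_iff_lim_eq hLc hr cE cVH cΛ cB Tc μ ν N).mp hcB
  have h2 := (d1Drift_pinned_iff_lim_eq hLc hr cE cVH cΛ cB' Tc μ ν N).mp hcB'
  rw [lim_affine_of_stepwise_affine hLc hr cE cVH cΛ Tc μ ν _ (haff _)] at h1 h2
  have hne := sub_ne_zero.mpr hgen
  have hkey : (cB' - cB) * (CauchyRate.lim (fun j => B12Beta.secondMoment (TbalOf Lc (JsBalAn1 (one_le_of_two_le hLc) hr cE cVH cΛ ((Lc : ℝ) ^ (2 * (3 + 1))) 1 Tc) j) μ ν) -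
      CauchyRate.lim (fun j => B12Beta.secondMoment (TbalOf Lc (JsBalAn1 (one_le_of_two_le hLc) hr cE cVH cΛ ((Lc : ℝ) ^ (2 * (3 + 1))) 0 Tc) j) μ ν)) = 0 := by
    linear_combination h2 - h1
  rcases mul_eq_zero.mp hkey with h | h
  · linarith
  · exact absurd h hne

/-- [folklore] **GENERIC CASE, THE END BIT IS MET BY SOME BORDER WEIGHT** (`0 < lim β⁰(cB)` for some `cB`) … -/
theorem exists_borderWeight_limPos (hLc : 2 ≤ Lc) (hr : r ∈ box (3 + 1) Lc) (cE cVH cΛ : ℝ)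
    (Tc : Fin 4 → Fin 4 → Fin 4 → Fin 4 → ℝ) (μ ν : Fin 4)
    (haff : ∀ (cB : ℝ) (j : ℕ), B12Beta.secondMoment (TbalOf Lc (JsBalAn1 (one_le_of_two_le hLc) hr cE cVH cΛ ((Lc : ℝ) ^ (2 * (3 + 1))) cB Tc) j) μ ν =
      (1 - cB) * B12Beta.secondMoment (TbalOf Lc (JsBalAn1 (one_le_of_two_le hLc) hr cE cVH cΛ ((Lc : ℝ) ^ (2 * (3 + 1))) 0 Tc) j) μ ν + cB * B12Beta.secondMoment (TbalOf Lc (JsBalAn1 (one_le_of_two_le hLc) hr cE cVH cΛ ((Lc : ℝ) ^ (2 * (3 + 1))) 1 Tc) j) μ ν)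
    (hgen : CauchyRate.lim (fun j => B12Beta.secondMoment (TbalOf Lc (JsBalAn1 (one_le_of_two_le hLc) hr cE cVH cΛ ((Lc : ℝ) ^ (2 * (3 + 1))) 1 Tc) j) μ ν) ≠
      CauchyRate.lim (fun j => B12Beta.secondMoment (TbalOf Lc (JsBalAn1 (one_le_of_two_le hLc) hr cE cVH cΛ ((Lc : ℝ) ^ (2 * (3 + 1))) 0 Tc) j) μ ν)) :
    ∃ cB : ℝ, 0 < CauchyRate.lim (fun j => B12Beta.secondMoment (TbalOf Lc (JsBalAn1 (one_le_of_two_le hLc) hr cE cVH cΛ ((Lc : ℝ) ^ (2 * (3 + 1))) cB Tc) j) μ ν) := by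
  obtain ⟨cB, hcB⟩ := exists_borderWeight_lim_eq hLc hr cE cVH cΛ Tc μ ν haff hgen 1
  exact ⟨cB, by rw [hcB]; exact one_pos⟩

/-- [folklore] **… AND MISSED BY SOME OTHER** (`lim β⁰(cB) < 0` for some `cB`): in the generic case the sign of the limit — the headline's β-binder at this
literal (`CapTailPinnedLimitSign` §2, GEN 9's `continuumYM4Torus_of_closedForm_pos`) — is decided by the border weight, not by the rest of the literal. -/
theorem exists_borderWeight_limNeg (hLc : 2 ≤ Lc) (hr : r ∈ box (3 + 1) Lc) (cE cVH cΛ : ℝ)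
    (Tc : Fin 4 → Fin 4 → Fin 4 → Fin 4 → ℝ) (μ ν : Fin 4)
    (haff : ∀ (cB : ℝ) (j : ℕ), B12Beta.secondMoment (TbalOf Lc (JsBalAn1 (one_le_of_two_le hLc) hr cE cVH cΛ ((Lc : ℝ) ^ (2 * (3 + 1))) cB Tc) j) μ ν =
      (1 - cB) * B12Beta.secondMoment (TbalOf Lc (JsBalAn1 (one_le_of_two_le hLc) hr cE cVH cΛ ((Lc : ℝ) ^ (2 * (3 + 1))) 0 Tc) j) μ ν + cB * B12Beta.secondMoment (TbalOf Lc (JsBalAn1 (one_le_of_two_le hLc) hr cE cVH cΛ ((Lc : ℝ) ^ (2 * (3 + 1))) 1 Tc) j) μ ν)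
    (hgen : CauchyRate.lim (fun j => B12Beta.secondMoment (TbalOf Lc (JsBalAn1 (one_le_of_two_le hLc) hr cE cVH cΛ ((Lc : ℝ) ^ (2 * (3 + 1))) 1 Tc) j) μ ν) ≠
      CauchyRate.lim (fun j => B12Beta.secondMoment (TbalOf Lc (JsBalAn1 (one_le_of_two_le hLc) hr cE cVH cΛ ((Lc : ℝ) ^ (2 * (3 + 1))) 0 Tc) j) μ ν)) :
    ∃ cB : ℝ, CauchyRate.lim (fun j => B12Beta.secondMoment (TbalOf Lc (JsBalAn1 (one_le_of_two_le hLc) hr cE cVH cΛ ((Lc : ℝ) ^ (2 * (3 + 1))) cB Tc) j) μ ν) < 0 := by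
  obtain ⟨cB, hcB⟩ := exists_borderWeight_lim_eq hLc hr cE cVH cΛ Tc μ ν haff hgen (-1)
  exact ⟨cB, by rw [hcB]; norm_num⟩

end Summit.QuantumFields.BalabanUV.Gaps.D1PinnedBorderWeightSocket

end
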